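import Mathlib
import Literature.Analysis.FluidPDE.Tao2016AveragedNS.RestartedCascadeFlows
import HarnessLib

/-!
# `RestartControl` tools I — the affine time change at a checkpoint, scale covariance of the
  quadratic term, checkpoint bookkeeping (helpers for item stmt-NavierStokesRegularity-20424, the
  shared support `RestartControl` of routes TaoLadderRungThree / TaoLadderRungTwo)

HONEST FRAMING: elementary calculus / bookkeeping lemmas about Tao-type MODEL lattice pseudo-flows
(Tao 2016, §6.4: the rescaling `a_k(s) := e_N⁻¹ X_{1,N+k}(t_N + (1+ε₀)^{−5N/2} e_N⁻¹ s)` at a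
checkpoint) in the cell vocabulary of the tree modules `LocalCascadeSolutions` /
`RestartedCascadeFlows`. Nothing here is a statement about the Navier–Stokes equations and nothing
is asserted about any particular coefficient table.

CONTENTS. `mapsTo_restart`, `contDiffOn_restart`, `hasDerivWithinAt_restart`, `derivWithin_restart`,
`integral_restart` (the time change `s ↦ t_N + s/γ` on `[0, τ]`: regularity, chain rule for
one-sided derivatives, interval-integral substitution); `quadTerm_restartX` (scale covariance of the
quadratic term: `quadTerm(S)_k(s) = quadTerm(X)_{N+k}(t_N + s/γ)/(e_N² (1+ε₀)^{5N/2})`);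
`t_mono`, `e_le_rpow_mul` (`e_n ≤ (1+ε₀)^{θ(N−n)} e_N`), `kappa_le` (the rescaled defect constants
`K_j e_N⁻¹(1+ε₀)^{−N/2} ≤ η` once `K_j ≤ η |X₀ i₀| (1+ε₀)^{n₀/2}`, for `θ ≤ 1/2`),
`exists_threshold` (Bernoulli), `weight_le` (the (4.5) weights transfer).
-/

noncomputable section

-- the sub-problem namespace `Summit.NavierStokesRegularity.NavierStokesRegularity` repeats the summit name by design (D-0017)
set_option linter.dupNamespace false

namespace Summit.NavierStokesRegularity.NavierStokesRegularity.Theorems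

open Set MeasureTheory intervalIntegral Literature.Analysis.FluidPDE Literature.Analysis.FluidPDE.TaoCascade

namespace RestartControl

/-! ### The affine time change `s ↦ t_N + s/γ` on closed intervals -/

section TimeChange

variable {f : ℝ → ℝ} {T tN γ τ : ℝ}

/-- The time change maps `[0, τ]` into `[0, T]` when `0 ≤ t_N`, `γ > 0`, `t_N + τ/γ ≤ T`. [folklore] -/
theorem mapsTo_restart (htN : 0 ≤ tN) (hγ : 0 < γ) (hτ : tN + τ / γ ≤ T) :
    MapsTo (fun s => tN + s / γ) (Icc 0 τ) (Icc 0 T) := by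
  intro s hs
  refine ⟨?_, ?_⟩
  · have := div_nonneg hs.1 hγ.le
    linarith
  · have := div_le_div_of_nonneg_right hs.2 hγ.le
    linarith

/-- Regularity transfers under the time change. [folklore] -/
theorem contDiffOn_restart (hf : ContDiffOn ℝ 1 f (Icc 0 T))
    (hmaps : MapsTo (fun s => tN + s / γ) (Icc 0 τ) (Icc 0 T)) (C : ℝ) :
    ContDiffOn ℝ 1 (fun s => f (tN + s / γ) / C) (Icc 0 τ) := by
  have h1 : ContDiffOn ℝ 1 (fun s : ℝ => tN + s / γ) (Icc 0 τ) := by fun_prop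
  exact (hf.comp h1 hmaps).div_const C

/-- The chain rule for the time change, one-sided derivatives within `[0, τ]`. [folklore] -/
theorem hasDerivWithinAt_restart (hf : ContDiffOn ℝ 1 f (Icc 0 T))
    (hmaps : MapsTo (fun s => tN + s / γ) (Icc 0 τ) (Icc 0 T)) (C : ℝ) {s : ℝ}
    (hs : s ∈ Icc 0 τ) :
    HasDerivWithinAt (fun u => f (tN + u / γ) / C)
      (derivWithin f (Icc 0 T) (tN + s / γ) / γ / C) (Icc 0 τ) s := by
  have hfd : HasDerivWithinAt f (derivWithin f (Icc 0 T) (tN + s / γ)) (Icc 0 T) (tN + s / γ) :=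
    ((hf.differentiableOn one_ne_zero) _ (hmaps hs)).hasDerivWithinAt
  have haff : HasDerivWithinAt (fun u => tN + u / γ) (1 / γ) (Icc 0 τ) s :=
    (((hasDerivAt_id' s).div_const γ).const_add tN).hasDerivWithinAt
  have hcomp := (hfd.comp s haff hmaps).div_const C
  refine (hcomp.congr_deriv (by ring)).congr_of_eventuallyEq ?_ ?_
  · exact Filter.Eventually.of_forall fun _ => rfl
  · rfl

/-- `derivWithin` form of the chain rule. [folklore] -/
theorem derivWithin_restart (hf : ContDiffOn ℝ 1 f (Icc 0 T))
    (hmaps : MapsTo (fun s => tN + s / γ) (Icc 0 τ) (Icc 0 T)) (C : ℝ) (hτ : 0 < τ) {s : ℝ}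
    (hs : s ∈ Icc 0 τ) :
    derivWithin (fun u => f (tN + u / γ) / C) (Icc 0 τ) s =
      derivWithin f (Icc 0 T) (tN + s / γ) / γ / C :=
  (hasDerivWithinAt_restart hf hmaps C hs).derivWithin (uniqueDiffOn_Icc hτ s hs)

/-- Change of variables in the cumulative energy:
`∫₀^s f(t_N + u/γ)/C du = (γ/C) ∫_{t_N}^{t_N + s/γ} f`. [folklore] -/
theorem integral_restart (hγ : γ ≠ 0) (C s : ℝ) :
    ∫ u in (0 : ℝ)..s, f (tN + u / γ) / C = γ / C * ∫ x in tN..(tN + s / γ), f x := by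
  rw [intervalIntegral.integral_div, intervalIntegral.integral_comp_add_div _ hγ, zero_div, add_zero,
    smul_eq_mul]
  ring

end TimeChange

/-! ### Scale covariance of the quadratic term -/

/-- **Scale covariance of `quadTerm`**: the quadratic term of the restarted amplitudes at shell `k`
is the quadratic term of the original amplitudes at shell `N+k`, divided by `e_N² (1+ε₀)^{5N/2}`.
[cite: Tao2016AveragedNS, §6.4 ("inserting this rescaling into (6.5)–(6.8) gives (6.44)–(6.48)")] -/
theorem quadTerm_restartX {ε₀ : ℝ} (hq : 0 < 1 + ε₀) {m : ℕ}
    (α : Fin m → Fin m → Fin m → ℤ × ℤ × ℤ → ℝ) (N : ℤ) (tN eN : ℝ) (X : Fin m → ℤ → ℝ → ℝ)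
    (i : Fin m) (k : ℤ) (s : ℝ) :
    quadTerm ε₀ α (restartX ε₀ N tN eN X) i k s =
      quadTerm ε₀ α X i (N + k) (tN + s / (eN * (1 + ε₀) ^ ((5 : ℝ) * N / 2))) /
        (eN ^ 2 * (1 + ε₀) ^ ((5 : ℝ) * N / 2)) := by
  unfold quadTerm
  rw [Finset.sum_div]
  refine Finset.sum_congr rfl fun i₁ _ => ?_
  rw [Finset.sum_div]
  refine Finset.sum_congr rfl fun i₂ _ => ?_
  rw [Finset.sum_div]
  refine Finset.sum_congr rfl fun μ _ => ?_
  simp only [restartX]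
  have hQ : 0 < (1 + ε₀) ^ ((5 : ℝ) * N / 2) := Real.rpow_pos_of_pos hq _
  have hidx₁ : N + (k - μ.2.2 + μ.1) = N + k - μ.2.2 + μ.1 := by ring
  have hidx₂ : N + (k - μ.2.2 + μ.2.1) = N + k - μ.2.2 + μ.2.1 := by ring
  have hpow : (1 + ε₀) ^ ((5 : ℝ) * ((k : ℝ) - (μ.2.2 : ℝ)) / 2) =
      (1 + ε₀) ^ ((5 : ℝ) * (((N + k : ℤ) : ℝ) - (μ.2.2 : ℝ)) / 2) / (1 + ε₀) ^ ((5 : ℝ) * N / 2) := by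
    rw [eq_div_iff hQ.ne', ← Real.rpow_add hq]
    congr 1
    push_cast
    ring
  rw [hidx₁, hidx₂, hpow]
  field_simp


/-! ### Checkpoint bookkeeping: monotone times, amplitude ratios, the defect constants -/

section Checkpoints

variable {ε₀ θ c : ℝ} {m : ℕ} {i₀ : Fin m} {n₀ : ℤ} {X₀ : Fin m → ℝ}
  {P : (Fin m → ℤ → ℝ) → (Fin m → ℤ → ℝ) → Prop} {N : ℤ} {X E : Fin m → ℤ → ℝ → ℝ} {t e : ℤ → ℝ}

/-- Checkpoint times are monotone: `t_n ≤ t_{n'}` for `n₀ ≤ n ≤ n' ≤ N`.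
[cite: Tao2016AveragedNS, §6.2 Prop. 6.3 (vii)] -/
theorem t_mono (h : ShellCheckpoints ε₀ θ c i₀ n₀ X₀ P N X E t e) {n n' : ℤ} (hn : n₀ ≤ n)
    (hnn' : n ≤ n') (hn' : n' ≤ N) : t n ≤ t n' := by
  obtain ⟨d, rfl⟩ : ∃ d : ℕ, n' = n + d := ⟨(n' - n).toNat, by omega⟩
  induction d with
  | zero => simp
  | succ d ih =>
      have h1 : n + (d : ℤ) ≤ N := by omega
      have hlt := h.mono (n + ((d + 1 : ℕ) : ℤ)) (by omega) hn'
      have hidx : n + ((d + 1 : ℕ) : ℤ) - 1 = n + (d : ℤ) := by push_cast; ring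
      rw [hidx] at hlt
      exact (ih (by omega) h1).trans hlt.le

/-- Amplitudes grow at most geometrically backwards: `e_n ≤ (1+ε₀)^{θ(N-n)} e_N` for
`n₀ ≤ n ≤ N` (iterate (6.12)). [cite: Tao2016AveragedNS, §6.2 Prop. 6.3 (6.12)] -/
theorem e_le_rpow_mul (h : ShellCheckpoints ε₀ θ c i₀ n₀ X₀ P N X E t e) (hq : 0 < 1 + ε₀)
    {n : ℤ} (hn : n₀ ≤ n) (hnN : n ≤ N) : e n ≤ (1 + ε₀) ^ (θ * ((N : ℝ) - n)) * e N := by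
  obtain ⟨d, rfl⟩ : ∃ d : ℕ, n = N - d := ⟨(N - n).toNat, by omega⟩
  induction d with
  | zero => simp
  | succ d ih =>
      have h1 : n₀ ≤ N - (d : ℤ) := by omega
      have hr := h.ratio (N - (d : ℤ)) (by omega) (by omega)
      have hidx : N - (d : ℤ) - 1 = N - ((d + 1 : ℕ) : ℤ) := by push_cast; ring
      rw [hidx] at hr
      -- `e_{N-d-1} ≤ (1+ε₀)^θ e_{N-d}`
      have hθpos : 0 < (1 + ε₀) ^ θ := Real.rpow_pos_of_pos hq _
      have hstep : e (N - ((d + 1 : ℕ) : ℤ)) ≤ (1 + ε₀) ^ θ * e (N - (d : ℤ)) := by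
        have h2 := mul_le_mul_of_nonneg_left hr hθpos.le
        rw [← mul_assoc, ← Real.rpow_add hq, add_neg_cancel, Real.rpow_zero, one_mul] at h2
        exact h2
      have ih' := ih h1 (by omega)
      calc e (N - ((d + 1 : ℕ) : ℤ)) ≤ (1 + ε₀) ^ θ * e (N - (d : ℤ)) := hstep
        _ ≤ (1 + ε₀) ^ θ * ((1 + ε₀) ^ (θ * ((N : ℝ) - ((N - (d : ℤ) : ℤ) : ℝ))) * e N) :=
            mul_le_mul_of_nonneg_left ih' hθpos.le
        _ = (1 + ε₀) ^ (θ * ((N : ℝ) - ((N - ((d + 1 : ℕ) : ℤ) : ℤ) : ℝ))) * e N := by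
            rw [← mul_assoc, ← Real.rpow_add hq]
            congr 2
            push_cast
            ring

/-- **The rescaled defect constants are small**: `K / (e_N (1+ε₀)^{N/2}) ≤ η` as soon as
`K ≤ η |X₀ i₀| (1+ε₀)^{n₀/2}`, for `θ ≤ 1/2` (since `e_N ≥ (1+ε₀)^{-θ(N-n₀)} |X₀ i₀|`).
[cite: Tao2016AveragedNS, §6.4 p. 34 ("e_N⁻¹ ≤ (1+ε₀)^{(N-n₀)/100} and hence (1+ε₀)^{2k−N/2} e_N⁻¹ ≤ (1+ε₀)^{2k−n₀/2}")] -/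
theorem kappa_le (h : ShellCheckpoints ε₀ θ c i₀ n₀ X₀ P N X E t e) (hε₀ : 0 < ε₀)
    (hθ : θ ≤ 1 / 2) (hN : n₀ ≤ N) {K η : ℝ} (hK : 0 ≤ K)
    (hKη : K ≤ η * |X₀ i₀| * (1 + ε₀) ^ ((n₀ : ℝ) / 2)) :
    K / (e N * (1 + ε₀) ^ ((N : ℝ) / 2)) ≤ η := by
  have hq : (0 : ℝ) < 1 + ε₀ := by linarith
  have hq1 : (1 : ℝ) ≤ 1 + ε₀ := by linarith
  have heN : 0 < e N := h.e_pos N hN le_rfl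
  have ha : 0 < |X₀ i₀| := by rw [← h.e_init]; exact h.e_pos n₀ le_rfl hN
  have hamp := h.rpow_mul_le_amp hε₀ N hN le_rfl
  -- `(1+ε₀)^{n₀/2} |X₀ i₀| ≤ e_N (1+ε₀)^{N/2}`
  have hlow : (1 + ε₀) ^ ((n₀ : ℝ) / 2) * |X₀ i₀| ≤ e N * (1 + ε₀) ^ ((N : ℝ) / 2) := by
    have hexp : (n₀ : ℝ) / 2 ≤ -θ * ((N : ℝ) - n₀) + (N : ℝ) / 2 := by
      have hNn : (0 : ℝ) ≤ (N : ℝ) - n₀ := by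
        have : (n₀ : ℝ) ≤ N := by exact_mod_cast hN
        linarith
      nlinarith
    calc (1 + ε₀) ^ ((n₀ : ℝ) / 2) * |X₀ i₀|
        ≤ (1 + ε₀) ^ (-θ * ((N : ℝ) - n₀) + (N : ℝ) / 2) * |X₀ i₀| :=
          mul_le_mul_of_nonneg_right (Real.rpow_le_rpow_of_exponent_le hq1 hexp) ha.le
      _ = (1 + ε₀) ^ (-θ * ((N : ℝ) - n₀)) * |X₀ i₀| * (1 + ε₀) ^ ((N : ℝ) / 2) := by
          rw [Real.rpow_add hq]; ring
      _ ≤ e N * (1 + ε₀) ^ ((N : ℝ) / 2) :=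
          mul_le_mul_of_nonneg_right hamp (Real.rpow_pos_of_pos hq _).le
  have hpos : 0 < (1 + ε₀) ^ ((n₀ : ℝ) / 2) * |X₀ i₀| := mul_pos (Real.rpow_pos_of_pos hq _) ha
  calc K / (e N * (1 + ε₀) ^ ((N : ℝ) / 2))
      ≤ K / ((1 + ε₀) ^ ((n₀ : ℝ) / 2) * |X₀ i₀|) := div_le_div_of_nonneg_left hK hpos hlow
    _ ≤ η := by
        rw [div_le_iff₀ hpos]
        linarith

/-- **Threshold**: `(1+ε₀)^{n₀/2} ≥ B` for all large `n₀` (Bernoulli).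
[cite: Tao2016AveragedNS, §6.4 Prop. 6.5 ("if n₀ is sufficiently large")] -/
theorem exists_threshold (hε₀ : 0 < ε₀) (B : ℝ) :
    ∃ N₀ : ℤ, ∀ n₀ : ℤ, N₀ ≤ n₀ → B ≤ (1 + ε₀) ^ ((n₀ : ℝ) / 2) := by
  refine ⟨⌈2 * (1 + |B| / ε₀)⌉, fun n₀ hn₀ => ?_⟩
  have h1 : 2 * (1 + |B| / ε₀) ≤ (n₀ : ℝ) := by
    have := Int.ceil_le.mp hn₀
    exact_mod_cast this
  have hBε : 0 ≤ |B| / ε₀ := div_nonneg (abs_nonneg B) hε₀.le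
  have hp1 : (1 : ℝ) ≤ (n₀ : ℝ) / 2 := by linarith
  have hbern := one_add_mul_self_le_rpow_one_add (s := ε₀) (by linarith) hp1
  have h2 : |B| ≤ (n₀ : ℝ) / 2 * ε₀ := by
    have h3 : |B| / ε₀ ≤ (n₀ : ℝ) / 2 := by linarith
    rwa [div_le_iff₀ hε₀] at h3
  linarith [le_abs_self B]

end Checkpoints

section Weights

variable {ε₀ : ℝ}

/-- The weights of (4.5) transfer: `1 + (1+ε₀)^{10k} ≤ (1 + (1+ε₀)^{-10N})(1 + (1+ε₀)^{10(N+k)})`.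
[cite: Tao2016AveragedNS, §4 (4.5)] -/
theorem weight_le (hq : 0 < 1 + ε₀) (N k : ℤ) :
    1 + (1 + ε₀) ^ ((10 : ℝ) * k) ≤
      (1 + (1 + ε₀) ^ (-(10 : ℝ) * N)) * (1 + (1 + ε₀) ^ ((10 : ℝ) * ((N + k : ℤ) : ℝ))) := by
  have hprod : (1 + ε₀) ^ (-(10 : ℝ) * N) * (1 + ε₀) ^ ((10 : ℝ) * ((N + k : ℤ) : ℝ)) =
      (1 + ε₀) ^ ((10 : ℝ) * k) := by
    rw [← Real.rpow_add hq]; congr 1; push_cast; ring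
  rw [← hprod]
  nlinarith [Real.rpow_pos_of_pos hq (-(10 : ℝ) * N),
    Real.rpow_pos_of_pos hq ((10 : ℝ) * ((N + k : ℤ) : ℝ))]

end Weights

end RestartControl

end Summit.NavierStokesRegularity.NavierStokesRegularity.Theorems

end
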